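import Literature.NumberTheory.DiophantineGeometry.AbcQualityProofs
import HarnessLib

/-!
# abc on the prime-power family `(1, q^k − 1, q^k)`

The triples `1 + (q^k − 1) = q^k` (`q ≥ 2`, `k ≥ 1`) are abc triples, so the abc conjecture
(the `ABC` summit `Literature.Abc.ABCConjecture`, taken here as the literal hypothesis `habc` so that this
Literature file does not import `Summits/`; `abc_imp_primePowerFamily (habc : ABC)` typechecks by unfolding) gives,
with ITS constant `C(ε)` (uniform in the base `q`),
`q^k < C(ε) · rad(1·(q^k − 1)·q^k)^{1+ε}` for all `q ≥ 2`, `k ≥ 1` — equivalently "the powerful part of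
`q^k − 1` is `O_ε(q^{εk})`", the special case of Ribenboim–Walsh (J. Number Theory 74 (1999)) for the
recurrence `q^k − 1`, and the input of Silverman's abc ⟹ non-Wieferich theorem (J. Number Theory 30 (1988)).
For prime `q` the radical is `q · rad(q^k − 1)` (`rad_one_pow_sub_one_pow`). This file exists so that the
route crux `Summit.ABC.ABC.Theses.IneffectiveSubspace.PrimePowerRadical` (abc on this family, per prime base)
is visibly BELOW the summit: any counterexample to it is a counterexample to abc.
-/

noncomputable section

open UniqueFactorizationMonoid

namespace Literature.NumberTheory.DiophantineGeometry

/-- `2 ≤ q^k` for `q ≥ 2`, `k ≥ 1`. [folklore] -/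
theorem two_le_pow_of_two_le {q k : ℕ} (hq : 2 ≤ q) (hk : 1 ≤ k) : 2 ≤ q ^ k :=
  le_trans hq (by simpa using Nat.pow_le_pow_right (by omega : 0 < q) hk)

/-- The members `(1, q^k − 1, q^k)` of the prime-power family are abc triples (`q ≥ 2`, `k ≥ 1`). [folklore] -/
theorem isABCTriple_one_pow_sub_one {q k : ℕ} (hq : 2 ≤ q) (hk : 1 ≤ k) :
    IsABCTriple 1 (q ^ k - 1) (q ^ k) := by
  have h2 := two_le_pow_of_two_le hq hk
  exact ⟨one_pos, by omega, by omega, Nat.coprime_one_left _⟩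

/-- `rad(1 · (q^k − 1) · q^k) = rad(q^k − 1) · q` for prime `q` and `k ≥ 1`. [folklore] -/
theorem rad_one_pow_sub_one_pow {q k : ℕ} (hq : q.Prime) (hk : 1 ≤ k) :
    rad 1 (q ^ k - 1) (q ^ k) = radical (q ^ k - 1) * q := by
  have h2 := two_le_pow_of_two_le hq.two_le hk
  have hcop : Nat.Coprime (q ^ k - 1) (q ^ k) :=
    (Nat.coprime_self_sub_left (by omega : 1 ≤ q ^ k)).mpr (Nat.coprime_one_left _)
  rw [rad_def, one_mul, radical_mul (Nat.coprime_iff_isRelPrime.mp hcop),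
    radical_pow _ (by omega : k ≠ 0), radical_eq_self_of_prime hq]

/-- **abc ⟹ abc on the prime-power family, uniformly in the base**: for every `ε > 0` there is `C > 0`
with `q^k < C · rad(1·(q^k−1)·q^k)^{1+ε}` for all `q ≥ 2`, `k ≥ 1` (the abc constant itself). [folklore] -/
theorem abc_imp_primePowerFamily
    (habc : ∀ ε : ℝ, 0 < ε → ∃ C : ℝ, 0 < C ∧ ∀ a b c : ℕ, IsABCTriple a b c →
      (c : ℝ) < C * ((rad a b c : ℕ) : ℝ) ^ (1 + ε)) :
    ∀ ε : ℝ, 0 < ε → ∃ C : ℝ, 0 < C ∧ ∀ q : ℕ, 2 ≤ q → ∀ k : ℕ, 1 ≤ k →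
      ((q ^ k : ℕ) : ℝ) < C * ((rad 1 (q ^ k - 1) (q ^ k) : ℕ) : ℝ) ^ (1 + ε) := by
  intro ε hε
  obtain ⟨C, hC, h⟩ := habc ε hε
  exact ⟨C, hC, fun q hq k hk => h 1 (q ^ k - 1) (q ^ k) (isABCTriple_one_pow_sub_one hq hk)⟩

/-- **abc ⟹ the per-prime-base form** (the shape of the route crux `PrimePowerRadical`):
`∀ q prime, ∀ ε > 0, ∃ C > 0, ∀ k ≥ 1, q^k < C · rad(1·(q^k−1)·q^k)^{1+ε}`. [folklore] -/
theorem abc_imp_primePowerFamily_prime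
    (habc : ∀ ε : ℝ, 0 < ε → ∃ C : ℝ, 0 < C ∧ ∀ a b c : ℕ, IsABCTriple a b c →
      (c : ℝ) < C * ((rad a b c : ℕ) : ℝ) ^ (1 + ε)) :
    ∀ q : ℕ, q.Prime → ∀ ε : ℝ, 0 < ε → ∃ C : ℝ, 0 < C ∧ ∀ k : ℕ, 1 ≤ k →
      ((q ^ k : ℕ) : ℝ) < C * ((rad 1 (q ^ k - 1) (q ^ k) : ℕ) : ℝ) ^ (1 + ε) := by
  intro q hq ε hε
  obtain ⟨C, hC, h⟩ := abc_imp_primePowerFamily habc ε hε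
  exact ⟨C, hC, fun k hk => h q hq.two_le k hk⟩

end Literature.NumberTheory.DiophantineGeometry

end
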